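import Mathlib
import Literature.Analysis.FluidPDE.Tao2016AveragedNS.ShiftSetCascadeFlows
import Summits.NavierStokesRegularity.NavierStokesRegularity.Theorems.TaoLadderRungTwoFlatCertificateGlueLohnerCascadeOn
import Summits.NavierStokesRegularity.NavierStokesRegularity.Theorems.TaoLadderRungTwoFlatCertificateGlueLohnerApproxOn
import HarnessLib

/-!
# Certificate glue on a shift set `𝕊`, XIX-b: THE LOHNER STEP FOR THE WINDOW SYSTEM WITH AN APPROXIMATE FRAME INVERSE
  (helper for items stmt-NavierStokesRegularity-22987 `FlatGapCertificatesV2` and stmt-24295 K_A₂(64); cell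
  harvest/h2-tao-ladder, p1 g14)

`stepCert_of_lohner_approx`: glue XIX (`stepCert_of_lohner`) with the exact right-inverse clause `C'·C'⁻¹ = 1` replaced by
the defect bound of glue XVIII-b (`lohner_land_approx`): `|C'(C'⁻¹ w) − w| ≤ κI` for the transported vectors `w = Vap_h(Cξ)`,
`ξ` in its box; `κI` enters the E-recursion. Float frames `M' = mid(J M)` with a float inverse (ival_tb2, E1-EMITTER-MEMO)
thus need no exact inversion on the emitter side.

HONEST FRAMING: Tao-type MODEL lattices; every clause is a HYPOTHESIS — nothing is computed or certified here, no stub is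
closed, nothing about the Navier–Stokes equations.
-/

noncomputable section

-- the sub-problem namespace repeats the summit name by design (D-0017)
set_option linter.dupNamespace false

namespace Summit.NavierStokesRegularity.NavierStokesRegularity.Theorems

open Set Finset Literature.Analysis.FluidPDE Literature.Analysis.FluidPDE.TaoCascade
open Summit.NavierStokesRegularity.NavierStokesRegularity.Theorems.TaylorModelReadout

namespace CertificateGlueOn

variable {m : ℕ} {𝕊 : Finset (ℤ × ℤ × ℤ)} {ε₀ : ℝ} {α : Fin m → Fin m → Fin m → ℤ × ℤ × ℤ → ℝ} {Kb Ka : ℤ}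
  {Eb Et : ℝ} {ω : ℤ → ℝ}

/-- **`StepCert` FROM A LOHNER-CHAIN CERTIFICATE STEP WITH AN APPROXIMATE FRAME INVERSE** (glue XIX with
`lohner_land_approx`: the defect `κI` of `C' C'⁻¹` on the transported vectors enters the E-recursion). [cite: Zgliczynski2002C1Lohner, §3–4 (Lohner-type parallelepiped frames and the C¹/variational enclosure); cell certificate format, Lohner step] -/
theorem stepCert_of_lohner_approx (hKb : 0 ≤ Kb) (hKa : 1 ≤ Ka) (hε : 0 < 1 + ε₀) (hω : ∀ k, 0 < ω k)
    {M : ℤ → ℝ} {t : ℕ → ℝ} {Node Hull : ℕ → (Fin m → ℤ → ℝ) → Prop} {j p : ℕ}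
    {b mC ρC E₀ E₁ dP NVh κI R δ A : ℝ} {x x' : Fin (m * winLen Kb Ka) → ℝ}
    {C Cn Cin : Matrix (Fin (m * winLen Kb Ka)) (Fin (m * winLen Kb Ka)) ℝ} {r r' : Fin (m * winLen Kb Ka) → ℝ}
    (hb : 0 ≤ b) (hmC : 0 ≤ mC) (hρC : 0 ≤ ρC) (hE₀ : 0 ≤ E₀) (hδ : 0 ≤ δ)
    (hh : 0 ≤ t (j + 1) - t j) (hguard : b * (mC + (ρC + E₀)) * (t (j + 1) - t j) < 1)
    (hB : ∀ i k, -Kb ≤ k → k ≤ Ka →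
      ∑ i₁ : Fin m, ∑ i₂ : Fin m, ∑ μ ∈ 𝕊,
        |α i₁ i₂ i μ| * (1 + ε₀) ^ ((5 : ℝ) * (k - μ.2.2) / 2) *
          (wExt Kb Ka ω (k - μ.2.2 + μ.1) * wExt Kb Ka ω (k - μ.2.2 + μ.2.1)) ≤ b * ω k)
    (hx : ∀ c, |x c| ≤ mC)
    (hC : ∀ ξ : Fin (m * winLen Kb Ka) → ℝ, (∀ c, |ξ c| ≤ r c) → ∀ c, |C.mulVec ξ c| ≤ ρC)
    (hdP : ∀ c, |TPoly (QcN 𝕊 ε₀ α Kb Ka ω) p x (t (j + 1) - t j) c - x' c| ≤ dP)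
    (hNVh : ∀ (v : Fin (m * winLen Kb Ka) → ℝ) (N : ℝ), 0 ≤ N → (∀ c, |v c| ≤ N) →
      ∀ c, |VPoly (QcN 𝕊 ε₀ α Kb Ka ω) p x v (t (j + 1) - t j) c| ≤ NVh * N)
    (hframe : ∀ ξ : Fin (m * winLen Kb Ka) → ℝ, (∀ c, |ξ c| ≤ r c) →
      ∀ c, |Cin.mulVec (VPoly (QcN 𝕊 ε₀ α Kb Ka ω) p x (C.mulVec ξ) (t (j + 1) - t j)) c| ≤ r' c)
    (hinv : ∀ ξ : Fin (m * winLen Kb Ka) → ℝ, (∀ c, |ξ c| ≤ r c) → ∀ c,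
      |(Cn.mulVec (Cin.mulVec (VPoly (QcN 𝕊 ε₀ α Kb Ka ω) p x (C.mulVec ξ) (t (j + 1) - t j))) -
        VPoly (QcN 𝕊 ε₀ α Kb Ka ω) p x (C.mulVec ξ) (t (j + 1) - t j)) c| ≤ κI)
    (hE₁ : κI + dP + NVh * E₀ + mC * (b * mC * (t (j + 1) - t j)) ^ (p + 1) / (1 - b * mC * (t (j + 1) - t j)) +
      (ρC + E₀) * ((((p : ℝ) + 2) * (b * mC * (t (j + 1) - t j)) ^ (p + 1) -
        ((p : ℝ) + 1) * (b * mC * (t (j + 1) - t j)) ^ (p + 2)) / (1 - b * mC * (t (j + 1) - t j)) ^ 2) +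
      ((mC + (ρC + E₀)) / (1 - b * (mC + (ρC + E₀)) * (t (j + 1) - t j)) - mC / (1 - b * mC * (t (j + 1) - t j)) -
        (ρC + E₀) / (1 - b * mC * (t (j + 1) - t j)) ^ 2) ≤ E₁)
    (hR : (mC + (ρC + E₀)) / (1 - b * (mC + (ρC + E₀)) * (t (j + 1) - t j)) ≤ R)
    (hMR : ∀ k, -Kb ≤ k → k ≤ Ka → M k ≤ R * ω k)
    (hdef : InputDefectOn 𝕊 ε₀ α Kb Ka Eb Et ω (fun _ k => -(R * ω k)) (fun _ k => R * ω k) δ)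
    (hA : gronwallBound 0 (2 * b * R) δ (t (j + 1) - t j) ≤ A)
    (hN : ∀ y, Node j y → InPara Kb Ka ω x C r E₀ y)
    (hH : ∀ y : Fin m → ℤ → ℝ, (∀ i k, -Kb ≤ k → k ≤ Ka →
      |y i k| ≤ ((mC + (ρC + E₀)) / (1 - b * (mC + (ρC + E₀)) * (t (j + 1) - t j)) + A) * ω k) → Hull j y)
    (hN' : ∀ y, InPara Kb Ka ω x' Cn r' (E₁ + A) y → Node (j + 1) y) :
    StepCert 𝕊 ε₀ α Kb Ka Eb Et M t Node Hull j := by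
  have hKK : 0 ≤ Ka + Kb + 1 := by omega
  set h := t (j + 1) - t j with hhdef
  set ρ := ρC + E₀ with hρdef
  have hρ0 : 0 ≤ ρ := by positivity
  set Rh := (mC + ρ) / (1 - b * (mC + ρ) * h) with hRh
  have hden : 0 < 1 - b * (mC + ρ) * h := by linarith
  have hRh0 : 0 ≤ Rh := div_nonneg (by positivity) hden.le
  have hR0 : 0 ≤ R := hRh0.trans hR
  set Q := QcN 𝕊 ε₀ α Kb Ka ω with hQ
  -- (B) in coordinates, linearity
  have hBQ : ∀ (u v : Fin (m * winLen Kb Ka) → ℝ) (Nu Nv : ℝ), 0 ≤ Nu → 0 ≤ Nv →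
      (∀ c, |u c| ≤ Nu * (fun _ => (1 : ℝ)) c) → (∀ c, |v c| ≤ Nv * (fun _ => (1 : ℝ)) c) →
      ∀ c, |Q u v c| ≤ b * Nu * Nv * (fun _ => (1 : ℝ)) c := by
    intro u v Nu Nv hNu hNv hu hv d
    have := qc_bound_of_table (𝕊 := 𝕊) (ε₀ := ε₀) (α := α) hε hω hKK hB (u ∘ finProdFinEquiv)
      (v ∘ finProdFinEquiv) Nu Nv hNu hNv (fun c => hu (finProdFinEquiv c)) (fun c => hv (finProdFinEquiv c))
      (finProdFinEquiv.symm d)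
    simpa [hQ, QcN] using this
  have hQl : ∀ u, IsLinearMap ℝ (Q u) := isLinearMap_QcN_right
  have hQr : ∀ v, IsLinearMap ℝ (fun u => Q u v) := isLinearMap_QcN_left
  -- the majorant along the step is below `Rh`
  have hmaj : ∀ u ∈ Icc 0 h, (mC + ρ) / (1 - b * (mC + ρ) * u) ≤ Rh := by
    intro u hu
    exact div_le_div_of_nonneg_left (by positivity) hden (by nlinarith [mul_nonneg hb (add_nonneg hmC hρ0), hu.2])
  refine stepCert_of_flowStep' (Start := InPara Kb Ka ω x C r E₀) (Land := InPara Kb Ka ω x' Cn r' E₁)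
    (Hlo := fun _ k => -(Rh * ω k)) (Hhi := fun _ k => Rh * ω k)
    (glo := fun _ k => -(R * ω k)) (ghi := fun _ k => R * ω k)
    hKb hKa hω (by positivity : 0 ≤ 2 * b * R) hδ hN (fun i k hk1 hk2 => ?_) (fun i k hk1 hk2 => ?_)
    (fieldLipOn_ball hε hω hR0 hB) hdef (fun z hz => ?_) hA (fun y hy => hH y fun i k hk1 hk2 => ?_)
    (fun y q hq hnear => hN' y (inPara_of_near hω hKK hq hnear))
  · have := hMR k hk1 hk2
    exact ⟨by linarith, this⟩
  · have : Rh * ω k ≤ R * ω k := mul_le_mul_of_nonneg_right hR (hω k).le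
    exact ⟨by linarith, this⟩
  · -- the exact flow from a node state: existence, hull, landing
    obtain ⟨ξ, e, hξ, he, hze⟩ := hz
    set v := C.mulVec ξ + e with hvdef
    have hv : ∀ c, |v c| ≤ ρ := fun c =>
      (abs_add_le _ _).trans (add_le_add (hC ξ hξ c) (he c))
    obtain ⟨ψ, hψ0, hψd, hψb⟩ := lohner_exists hQl hQr hb hBQ hh hmC hρ0 hx hguard v hv
    have hland := lohner_land_approx hQl hQr hb hBQ hh hmC hρC hE₀ hx hguard hC hdP hNVh hframe hinv hE₁ ξ e hξ he
      ψ hψ0 hψd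
    -- cascade family of the coordinate solution
    have hstart : (ψ 0) ∘ finProdFinEquiv = wcoord Kb Ka ω z := by
      rw [hψ0, ← hze]; funext c; simp [xcoord]
    refine ⟨fun i k u => wstate Kb Ka ω ((ψ u) ∘ finProdFinEquiv) i k, fun i k hk1 hk2 => ?_,
      fun i k hk1 hk2 u hu => ?_, fun u hu i k hk1 hk2 => ?_, ?_⟩
    · -- start
      show wstate Kb Ka ω ((ψ 0) ∘ finProdFinEquiv) i k = z i k
      rw [hstart, wstate_wcoord hω z i hk1 hk2]
    · -- the window equation (as in glue XVI)
      have hlt : (k + Kb).toNat < winLen Kb Ka := by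
        unfold winLen; rw [Int.toNat_lt_toNat (by omega)]; omega
      set c : Fin (winLen Kb Ka) := ⟨(k + Kb).toNat, hlt⟩ with hc
      have hsh : shellAt Kb c = k := by
        simp only [shellAt, hc]; rw [Int.toNat_of_nonneg (by omega)]; ring
      have hfun : (fun u => wstate Kb Ka ω ((ψ u) ∘ finProdFinEquiv) i k) =
          fun u => ω k * ψ u (finProdFinEquiv (i, c)) := by
        funext u
        have := wstate_on (ω := ω) ((ψ u) ∘ finProdFinEquiv) hKK i c
        rw [hsh] at this
        simpa using this
      dsimp only
      rw [hfun]
      have hd := (hasDerivWithinAt_pi.1 (hψd u hu) (finProdFinEquiv (i, c))).const_mul (ω k)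
      refine hd.congr_deriv ?_
      have hslice : slice (fun i k u => wstate Kb Ka ω ((ψ u) ∘ finProdFinEquiv) i k) u =
          wstate Kb Ka ω ((ψ u) ∘ finProdFinEquiv) := by
        funext i' k'; rfl
      rw [hslice, truncField_eq_biFieldOn]
      have hQapp : Q (ψ u) (ψ u) (finProdFinEquiv (i, c)) =
          biFieldOn 𝕊 ε₀ α Kb Ka (wstate Kb Ka ω ((ψ u) ∘ finProdFinEquiv))
            (wstate Kb Ka ω ((ψ u) ∘ finProdFinEquiv)) i k / ω k := by
        simp only [hQ, QcN, Qc, Equiv.symm_apply_apply, wcoord]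
        rw [hsh]
      rw [hQapp]
      field_simp [(hω k).ne']
    · -- the hull (majorant)
      have hlt : (k + Kb).toNat < winLen Kb Ka := by
        unfold winLen; rw [Int.toNat_lt_toNat (by omega)]; omega
      set c : Fin (winLen Kb Ka) := ⟨(k + Kb).toNat, hlt⟩ with hc
      have hsh : shellAt Kb c = k := by
        simp only [shellAt, hc]; rw [Int.toNat_of_nonneg (by omega)]; ring
      have hvb := hψb u hu (finProdFinEquiv (i, c))
      have := wstate_on (ω := ω) ((ψ u) ∘ finProdFinEquiv) hKK i c
      rw [hsh] at this
      simp only [slice_apply]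
      rw [this]
      have habs : |ω k * ((ψ u) ∘ finProdFinEquiv) (i, c)| ≤ Rh * ω k := by
        rw [abs_mul, abs_of_pos (hω k), mul_comm]
        exact mul_le_mul_of_nonneg_right ((by simpa using hvb : |ψ u (finProdFinEquiv (i, c))| ≤ _).trans
          (hmaj u hu)) (hω k).le
      exact abs_le.mp habs
    · -- landing in the next parallelepiped
      obtain ⟨ξ', e', hξ', he', hψh⟩ := hland
      refine ⟨ξ', e', hξ', he', ?_⟩
      show xcoord Kb Ka ω (slice (fun i k u => wstate Kb Ka ω ((ψ u) ∘ finProdFinEquiv) i k) h) = _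
      have hsl : slice (fun i k u => wstate Kb Ka ω ((ψ u) ∘ finProdFinEquiv) i k) h =
          wstate Kb Ka ω ((ψ h) ∘ finProdFinEquiv) := by funext i' k'; rfl
      rw [hsl, ← hψh]
      funext d
      simp only [xcoord, wcoord_wstate hω hKK, Function.comp_apply, Equiv.apply_symm_apply]
  · have := hy i k hk1 hk2
    rw [abs_le]
    constructor <;> nlinarith [this.1, this.2, (hω k).le]

end CertificateGlueOn

end Summit.NavierStokesRegularity.NavierStokesRegularity.Theorems

end
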